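import Mathlib
import Summits.Ventures.HodgeRepro.Tier4.Target
import Summits.Ventures.HodgeRepro.Tier4.Line3.KMDatum

/-!
# Tier4/Line3/Witness/MajCoercive — coercivity of the Kudla–Millson majorant on the ball
(seat t4-L2-p2, gen 0, for the `summable` clause of the R4 witness of LINE L3's `ThetaData`, t4-plan-3 S12460;
blind re-derivation cell `pub-hodge-repro`, Tier 4, README §9–§10)

`maj_ge`: for `z` in the ball, `maj y z ≥ (1 − |z|²)/4 · Σ_i ‖y_i‖²`.  With `s = ‖(y₀, y₁)‖`, `u = |y₂|`,
`v = |z̄₀y₀ + z̄₁y₁| ≤ ρ s` (`ρ = |z|`, Cauchy–Schwarz) and `|ℓ| ≥ |u − v|` (`ℓ = ⟨w_z, Jy⟩`): if `u ≤ ρ s` the positive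
part `s² − u² ≥ (1 − ρ²) s²` alone gives the bound; if `u > ρ s` the identity
`(1 − ρ²)(s² − u²) + 2 (u − ρ s)² = (1 − ρ)² (s² + u²) + 2ρ (s − u)²` does, with `1 − ρ ≥ (1 − ρ²)/2`.
Mathlib + the target's definitions; no printed input.  Nothing here says anything about the status of the Hodge
conjecture for CM abelian varieties, which is NOT proved (HC_CM is NOT proved by anyone in this repository).
-/

set_option autoImplicit false

noncomputable section

namespace Summit.Ventures.HodgeRepro.Tier4.Line3

open Summit.Ventures.HodgeRepro.Tier4
open Matrix
open scoped ComplexConjugate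

/-- `(y,y)_J = |y₀|² + |y₁|² − |y₂|²`. -/
theorem re_hermJ_self (y : Fin 3 → ℂ) :
    (star y ⬝ᵥ (J *ᵥ y)).re = ‖y 0‖ ^ 2 + ‖y 1‖ ^ 2 - ‖y 2‖ ^ 2 := by
  simp [dotProduct, J, Matrix.mulVec_diagonal, Fin.sum_univ_three, Complex.sq_norm, Complex.normSq_apply,
    Complex.mul_re, Complex.conj_re, Complex.conj_im]
  ring

/-- `⟨w_z, Jy⟩ = z̄₀y₀ + z̄₁y₁ − y₂`. -/
theorem star_lift3_dot_J (y : Fin 3 → ℂ) (z : Fin 2 → ℂ) :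
    star (lift3 z) ⬝ᵥ (J *ᵥ y) = conj (z 0) * y 0 + conj (z 1) * y 1 - y 2 := by
  simp [dotProduct, J, lift3, Matrix.mulVec_diagonal, Fin.sum_univ_three]
  ring

/-- Cauchy–Schwarz in `ℂ²`: `|z̄₀y₀ + z̄₁y₁|² ≤ |z|² (|y₀|² + |y₁|²)`. -/
theorem norm_sq_pair_le (z : Fin 2 → ℂ) (y : Fin 3 → ℂ) :
    ‖conj (z 0) * y 0 + conj (z 1) * y 1‖ ^ 2 ≤ nsq z * (‖y 0‖ ^ 2 + ‖y 1‖ ^ 2) := by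
  have h : nsq z * (‖y 0‖ ^ 2 + ‖y 1‖ ^ 2) - ‖conj (z 0) * y 0 + conj (z 1) * y 1‖ ^ 2
      = ‖z 0 * y 1 - z 1 * y 0‖ ^ 2 := by
    simp only [nsq, Complex.sq_norm, Complex.normSq_apply, Complex.add_re, Complex.add_im, Complex.sub_re,
      Complex.sub_im, Complex.mul_re, Complex.mul_im, Complex.conj_re, Complex.conj_im]
    ring
  nlinarith [sq_nonneg ‖z 0 * y 1 - z 1 * y 0‖]

/-- **Coercivity of the majorant on the ball**: `maj y z ≥ (1 − |z|²)/4 · Σ_i ‖y_i‖²`. -/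
theorem maj_ge (y : Fin 3 → ℂ) (z : Fin 2 → ℂ) (hz : z ∈ ball) :
    (1 - nsq z) / 4 * ∑ i, ‖y i‖ ^ 2 ≤ maj y z := by
  have hn1 : nsq z < 1 := hz
  have hn0 : 0 ≤ nsq z := by unfold nsq; positivity
  set n := nsq z with hn
  set ρ := Real.sqrt n with hρ
  have hρ0 : 0 ≤ ρ := Real.sqrt_nonneg n
  have hρ2 : ρ ^ 2 = n := Real.sq_sqrt hn0
  have hρ1 : ρ < 1 := by
    rw [hρ, Real.sqrt_lt' one_pos]; simpa using hn1
  set s2 := ‖y 0‖ ^ 2 + ‖y 1‖ ^ 2 with hs2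
  set s := Real.sqrt s2 with hs
  have hs2nn : 0 ≤ s2 := by positivity
  have hs0 : 0 ≤ s := Real.sqrt_nonneg _
  have hss : s ^ 2 = s2 := Real.sq_sqrt hs2nn
  set u := ‖y 2‖ with hu
  have hu0 : 0 ≤ u := norm_nonneg _
  set w := conj (z 0) * y 0 + conj (z 1) * y 1 with hw
  set v := ‖w‖ with hv
  have hv0 : 0 ≤ v := norm_nonneg _
  have hvle : v ≤ ρ * s := by
    have h1 : v ^ 2 ≤ (ρ * s) ^ 2 := by
      rw [mul_pow, hρ2, hss]
      exact norm_sq_pair_le z y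
    exact (pow_le_pow_iff_left₀ hv0 (mul_nonneg hρ0 hs0) two_ne_zero).mp h1
  -- `|ℓ| ≥ |v − u|`
  have hℓ : |v - u| ≤ ‖w - y 2‖ := by
    have := abs_norm_sub_norm_le w (y 2)
    simpa [hv, hu] using this
  have hℓ2 : (v - u) ^ 2 ≤ ‖w - y 2‖ ^ 2 := by
    have := sq_abs (v - u)
    nlinarith [hℓ, abs_nonneg (v - u), norm_nonneg (w - y 2)]
  have hpos : 0 < 1 - n := by linarith
  -- unfold the majorant
  have hmaj : maj y z = s2 - u ^ 2 + 2 * ‖w - y 2‖ ^ 2 / (1 - n) := by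
    unfold maj
    rw [re_hermJ_self, star_lift3_dot_J]
  rw [hmaj, Fin.sum_univ_three]
  have hsum : ‖y 0‖ ^ 2 + ‖y 1‖ ^ 2 + ‖y 2‖ ^ 2 = s2 + u ^ 2 := by rw [hs2, hu]
  rw [hsum]
  -- reduce to a polynomial inequality multiplied by `1 − n > 0`
  have key : (1 - n) * ((1 - n) / 4 * (s2 + u ^ 2)) ≤ (1 - n) * (s2 - u ^ 2 + 2 * ‖w - y 2‖ ^ 2 / (1 - n)) := by
    have hrhs : (1 - n) * (s2 - u ^ 2 + 2 * ‖w - y 2‖ ^ 2 / (1 - n)) = (1 - n) * (s2 - u ^ 2) + 2 * ‖w - y 2‖ ^ 2 := by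
      field_simp
    rw [hrhs]
    rcases le_or_gt u (ρ * s) with hcase | hcase
    · -- `u ≤ ρ s`: the positive part alone suffices
      have hu2 : u ^ 2 ≤ n * s2 := by
        have := pow_le_pow_left₀ hu0 hcase 2
        rwa [mul_pow, hρ2, hss] at this
      nlinarith [sq_nonneg (1 - n), mul_nonneg hpos.le hs2nn, sq_nonneg ‖w - y 2‖, mul_nonneg hpos.le hu0]
    · -- `u > ρ s`: `|ℓ| ≥ u − ρ s` and the identity `(1−n)(s²−u²) + 2(u−ρs)² = (1−ρ)²(s²+u²) + 2ρ(s−u)²`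
      have hℓ3 : (u - ρ * s) ^ 2 ≤ ‖w - y 2‖ ^ 2 := by
        have h1 : u - ρ * s ≤ u - v := by linarith
        have h2 : 0 ≤ u - ρ * s := by linarith
        have h3 : (u - ρ * s) ^ 2 ≤ (u - v) ^ 2 := by
          have := pow_le_pow_left₀ h2 h1 2
          simpa using this
        nlinarith [hℓ2, h3]
      have hρn : 1 - n = (1 - ρ) * (1 + ρ) := by rw [← hρ2]; ring
      have h1ρ : (1 - n) / 2 ≤ 1 - ρ := by rw [hρn]; nlinarith
      have h1ρ' : ((1 - n) / 2) ^ 2 ≤ (1 - ρ) ^ 2 := by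
        have := pow_le_pow_left₀ (by linarith) h1ρ 2
        exact this
      nlinarith [hℓ3, sq_nonneg (s - u), mul_nonneg hρ0 (sq_nonneg (s - u)), hss, h1ρ']
  exact le_of_mul_le_mul_left key hpos

end Summit.Ventures.HodgeRepro.Tier4.Line3
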